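import Mathlib

/-!
# Route BarrierLever — item `KRSTNoGoBelow12cOnB05` (stmt-ValiantsHypothesis-19340), part 2/6:
# linear forms, permanents with all-but-one rows equal to one, independent rows in a span

Lean text authored by the cell planner seat `valiant-natproofs-p2` (gen 3, HOME/Glue-p2g3.lean =
HOME/RowZero-p2g3.lean v5 §Glue, referee PASS), landed by the prover seat. Mathlib only.

* `linForm c = Σ_t c_t X_t` and **`algebraicIndependent_linForm`**: linearly independent linear forms
  are algebraically independent (a retraction built from a left inverse).
* `permanent_of_rows_one` — a matrix all of whose rows but row `i₀` are all-ones has permanent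
  `(#α − 1)! · Σ_j A i₀ j` (`card_filter_perm_apply_eq`: `#{σ : σ i₀ = j} = (#α − 1)!`).
* `exists_linearIndependent_rows` — if `|I|` linearly independent functions lie in the column span
  of a matrix `M`, then `M` has `|I|` linearly independent rows (row rank = column rank).

WHAT THIS IS NOT: generic linear algebra; nothing about circuits or KRST here.
-/

-- layout Summits/ValiantsHypothesis/ValiantsHypothesis forces the duplicated namespace component
set_option linter.dupNamespace false

noncomputable section

open MvPolynomial Finset

namespace Summit.ValiantsHypothesis.ValiantsHypothesis.Theorems.BarrierLever.KRSTNoGoBelow12cOnB05.Glue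

section LinForms

variable {F : Type*} [Field F] {τ : Type*} [Fintype τ]

/-- The linear form with coefficient vector `c`. -/
noncomputable def linForm (c : τ → F) : MvPolynomial τ F := ∑ t, c t • X t

/-- **Linearly independent linear forms are algebraically independent** (a retraction `X_t ↦ Σ_i g(e_t)_i X_i`
built from a left inverse `g` of `e_i ↦ c_i` sends `ℓ_i ↦ X_i`). -/
theorem algebraicIndependent_linForm {ι : Type*} [Fintype ι] (c : ι → τ → F)
    (hc : LinearIndependent F c) : AlgebraicIndependent F fun i => linForm (c i) := by
  classical
  let f : (ι → F) →ₗ[F] (τ → F) := Fintype.linearCombination F c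
  have hker : LinearMap.ker f = ⊥ := by
    rw [LinearMap.ker_eq_bot']
    intro g hg
    rw [Fintype.linearCombination_apply] at hg
    funext i
    exact Fintype.linearIndependent_iff.mp hc g hg i
  obtain ⟨g, hg⟩ := LinearMap.exists_leftInverse_of_injective f hker
  let L : (τ → F) →ₗ[F] MvPolynomial ι F :=
    (Fintype.linearCombination F (X : ι → MvPolynomial ι F)).comp g
  let R : MvPolynomial τ F →ₐ[F] MvPolynomial ι F := aeval fun t => L (Pi.single t 1)
  have hR : ∀ v : τ → F, R (linForm v) = L v := by
    intro v
    simp only [linForm, map_sum, map_smul, R, aeval_X]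
    calc ∑ t, v t • L (Pi.single t 1) = ∑ t, L (Pi.single t (v t)) := by
          refine Finset.sum_congr rfl fun t _ => ?_
          rw [← map_smul, ← Pi.single_smul, smul_eq_mul, mul_one]
      _ = L (∑ t, Pi.single t (v t)) := by rw [map_sum]
      _ = L v := by rw [Finset.univ_sum_single]
  have hRX : ∀ i, R (linForm (c i)) = X i := by
    intro i
    rw [hR]
    show Fintype.linearCombination F X (g (c i)) = X i
    have : c i = f (Pi.single i 1) := by
      simp [f, Fintype.linearCombination_apply_single]
    rw [this]
    show Fintype.linearCombination F X ((g ∘ₗ f) (Pi.single i 1)) = X i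
    rw [hg, LinearMap.id_apply, Fintype.linearCombination_apply_single, one_smul]
  refine AlgebraicIndependent.of_comp R ?_
  have : (⇑R ∘ fun i => linForm (c i)) = (X : ι → MvPolynomial ι F) := funext hRX
  rw [this]
  exact MvPolynomial.algebraicIndependent_X ι F

/-- `linForm` of an indicator vector. -/
theorem linForm_single [DecidableEq τ] (y : τ) (a : F) : linForm (Pi.single y a : τ → F) = a • X y := by
  unfold linForm
  rw [Finset.sum_eq_single y]
  · rw [Pi.single_eq_same]
  · intro t _ ht; rw [Pi.single_eq_of_ne ht, zero_smul]
  · intro h; exact absurd (Finset.mem_univ _) h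

/-- `linForm` is additive in the coefficient vector. -/
theorem linForm_add (c d : τ → F) : linForm (c + d) = linForm c + linForm d := by
  unfold linForm; rw [← Finset.sum_add_distrib]; simp [add_smul]

/-- `linForm` commutes with scalars. -/
theorem linForm_smul (a : F) (c : τ → F) : linForm (a • c) = a • linForm c := by
  unfold linForm; rw [Finset.smul_sum]; simp [smul_smul]

/-- `linForm` of a finite sum of coefficient vectors. -/
theorem linForm_sum {κ : Type*} (s : Finset κ) (c : κ → τ → F) :
    linForm (∑ k ∈ s, c k) = ∑ k ∈ s, linForm (c k) := by
  classical
  induction s using Finset.induction_on with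
  | empty => simp [linForm]
  | insert k s hk ih => rw [Finset.sum_insert hk, Finset.sum_insert hk, linForm_add, ih]

end LinForms

section Perm

variable {R : Type*} [CommRing R] {α : Type*} [Fintype α] [DecidableEq α]

/-- All fibres `{σ : σ i₀ = j}` of `σ ↦ σ i₀` have `(|α| - 1)!` elements. -/
theorem card_filter_perm_apply_eq (i₀ j : α) :
    (Finset.univ.filter fun σ : Equiv.Perm α => σ i₀ = j).card = (Fintype.card α - 1).factorial := by
  -- all fibres are equinumerous
  have heq : ∀ j j' : α, (Finset.univ.filter fun σ : Equiv.Perm α => σ i₀ = j).card =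
      (Finset.univ.filter fun σ : Equiv.Perm α => σ i₀ = j').card := by
    intro j j'
    refine Finset.card_bij' (fun σ _ => Equiv.swap j j' * σ) (fun σ _ => Equiv.swap j j' * σ)
      ?_ ?_ ?_ ?_
    · intro σ hσ
      rw [Finset.mem_filter] at hσ ⊢
      refine ⟨Finset.mem_univ _, ?_⟩
      rw [Equiv.Perm.mul_apply, hσ.2, Equiv.swap_apply_left]
    · intro σ hσ
      rw [Finset.mem_filter] at hσ ⊢
      refine ⟨Finset.mem_univ _, ?_⟩
      rw [Equiv.Perm.mul_apply, hσ.2, Equiv.swap_apply_right]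
    · intro σ _; rw [← mul_assoc, Equiv.swap_mul_self, one_mul]
    · intro σ _; rw [← mul_assoc, Equiv.swap_mul_self, one_mul]
  -- the fibres partition `Perm α`
  have hsum : ∑ j' : α, (Finset.univ.filter fun σ : Equiv.Perm α => σ i₀ = j').card =
      (Fintype.card α).factorial := by
    rw [← Fintype.card_perm, ← Finset.card_univ,
      Finset.card_eq_sum_card_fiberwise (f := fun σ : Equiv.Perm α => σ i₀) (t := Finset.univ)
        fun _ _ => Finset.mem_univ _]
  rw [Finset.sum_congr rfl fun j' _ => heq j' j, Finset.sum_const, Finset.card_univ, smul_eq_mul] at hsum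
  have hpos : 0 < Fintype.card α := Fintype.card_pos_iff.mpr ⟨i₀⟩
  obtain ⟨k, hk⟩ : ∃ k, Fintype.card α = k + 1 := ⟨Fintype.card α - 1, by omega⟩
  rw [hk, Nat.factorial_succ] at hsum
  rw [hk, Nat.add_sub_cancel]
  exact Nat.eq_of_mul_eq_mul_left (by omega) hsum

/-- **Permanent of a matrix all of whose rows except row `i₀` are all-ones**:
`per A = (|α| - 1)! · Σ_j A i₀ j`. -/
theorem permanent_of_rows_one (i₀ : α) (A : Matrix α α R) (hA : ∀ i j, i ≠ i₀ → A i j = 1) :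
    A.permanent = ((Fintype.card α - 1).factorial : R) * ∑ j, A i₀ j := by
  unfold Matrix.permanent
  have h1 : ∀ σ : Equiv.Perm α, ∏ i, A (σ i) i = A i₀ (σ.symm i₀) := by
    intro σ
    rw [Finset.prod_eq_single (σ.symm i₀)]
    · rw [Equiv.apply_symm_apply]
    · intro i _ hi
      apply hA
      intro h
      apply hi
      rw [← h, Equiv.symm_apply_apply]
    · intro h; exact absurd (Finset.mem_univ _) h
  simp_rw [h1]
  rw [Fintype.sum_equiv (Equiv.inv (Equiv.Perm α)) (fun σ => A i₀ (σ.symm i₀)) (fun σ => A i₀ (σ i₀))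
    fun σ => rfl]
  rw [← Finset.sum_fiberwise_of_maps_to (s := Finset.univ) (t := Finset.univ)
    (g := fun σ : Equiv.Perm α => σ i₀) fun _ _ => Finset.mem_univ _]
  rw [Finset.mul_sum]
  refine Finset.sum_congr rfl fun j _ => ?_
  rw [Finset.sum_congr rfl fun σ hσ => by rw [(Finset.mem_filter.mp hσ).2], Finset.sum_const,
    card_filter_perm_apply_eq, nsmul_eq_mul]

end Perm

section Rows

variable {F : Type*} [Field F]

/-- **Row extraction.** If `|I|` linearly independent functions `φ α : X → F` lie in the span of the columns
`x ↦ M x y` of `M`, then `M` has `|I|` linearly independent rows (row rank = column rank). -/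
theorem exists_linearIndependent_rows {X Y : Type*} [Finite X] [Fintype Y] (M : X → Y → F)
    {I : Type*} [Fintype I] (φ : I → X → F) (hφ : LinearIndependent F φ)
    (hspan : ∀ α, φ α ∈ Submodule.span F (Set.range fun y : Y => fun x => M x y)) :
    ∃ e : Fin (Fintype.card I) → X, Function.Injective e ∧ LinearIndependent F fun k => M (e k) := by
  classical
  let A : Matrix X Y F := Matrix.of M
  let W : Submodule F (X → F) := Submodule.span F (Set.range A.col)
  have hW : ∀ α, φ α ∈ W := hspan
  -- |I| ≤ finrank W
  have h1 : Fintype.card I ≤ Module.finrank F W := by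
    let φ' : I → W := fun α => ⟨φ α, hW α⟩
    have hφ' : LinearIndependent F φ' := LinearIndependent.of_comp W.subtype hφ
    exact hφ'.fintype_card_le_finrank
  -- finrank W = rank A = finrank (row span)
  have h2 : Module.finrank F W = Module.finrank F (Submodule.span F (Set.range A.row)) := by
    rw [← Matrix.rank_eq_finrank_span_cols, Matrix.rank_eq_finrank_span_row]
  -- extract independent rows
  obtain ⟨κ, a, ha, hsp, hli⟩ := exists_linearIndependent' F (A.row : X → Y → F)
  haveI : Finite κ := Finite.of_injective a ha
  letI : Fintype κ := Fintype.ofFinite κ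
  have h3 : Fintype.card κ = Module.finrank F (Submodule.span F (Set.range A.row)) := by
    rw [← hsp, finrank_span_eq_card hli]
  have hle : Fintype.card I ≤ Fintype.card κ := by rw [h3, ← h2]; exact h1
  let emb : Fin (Fintype.card I) ↪ κ :=
    (Fin.castLEEmb hle).trans (Fintype.equivFin κ).symm.toEmbedding
  refine ⟨a ∘ emb, ha.comp emb.injective, ?_⟩
  exact hli.comp emb emb.injective

end Rows


end Summit.ValiantsHypothesis.ValiantsHypothesis.Theorems.BarrierLever.KRSTNoGoBelow12cOnB05.Glue

end
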